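import Summits.AtomisticToContinuum.Crystallization.Theorems.FrustratedLawDichotomyStrainedPatchHomCurvLJAniso

/-!
# ANISOTROPIC force-Jacobian floor, FULL MATRIX SHIFT: certify `⟨Δ, DΔ⟩ + λ‖Δ‖² ≤ Σ segGd` for any symmetric integer matrix `D`

decomp-a2c hand-1 g28 (crux `AperiodicFrustratedLawGap`, stmt-AtomisticToContinuum-27623; `(H) HomFloor (1/625)`, hcp half; BUDGET-F §3 T″ two-stage /
critic row 1089 (2)(c)).  The corner arithmetic needs the c-axis stiffness (`≈ 38`) and not only `λ_min ≈ 6.5`: at the corner `f₀(2⁻¹¹) = 0.0097 ≈ 0.9σ₁`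
(`…HomSlopeLJ.slopeGsLJ`, reference box), so the isotropic confinement radius `(σ₁+f₀)/6.5 = 3.2e-3` costs `1.7 × 3.2e-3 = 5.4e-3` of misfit (> the
0.0037 window) whereas the FULL quadratic form of the corner Hessian `H ≈ [[8.75,0,0],[0,7.96,−5.85],[0,−5.85,41.7]]` (the e_yz shear couples `y` and
`c`: a DIAGONAL shift, `…HomCurvLJAniso`, loses the coupling and certifies only `3.8 + 28Δ_c²`-type forms) gives `|Δ_c| ≤ max_u u_c/⟨u,Hu⟩·(σ₁+f₀) =
9.2e-4` (cost 1.6e-3 ✓).  The sign-vertex test certifies `M − D − κ ⪰ 0` for any symmetric `D`: shift every entry of the interval matrix.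

* §1 `shiftMat`, `mem_shiftMat`, ★ `quadForm_ge_mat_of_hertzTest`;
* §2 ★ `curvCheckLJM c w Lc Ln D lamS`, `curvLamLJM` (+ `curvCheckLJM_of_curvLamLJM`) and ★★★ `curvLJ_floorM_of_check`:
  `(lamS/SC)‖U(ξ−ξ₀)‖² + Σ_ij (D_ij/SC)(U(ξ−ξ₀))_i(U(ξ−ξ₀))_j ≤ Σ_b segGd (fun x => x⁻¹^7 − x⁻¹^13) (p_b(ξ₀)) (U(ξ−ξ₀)) s` for every `s ∈ (0,1)` — for a
  FIXED segment this is the `hcurv` input of the ring lemma with `lam := lamS/SC + ⟨Δ, DΔ⟩/(SC‖Δ‖²)`.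

Kernel definitions + soundness; 0 sorry; standard axioms; no instances / notation / `#eval`.  `--supports stmt-AtomisticToContinuum-27623`.
-/

noncomputable section

namespace Summit.AtomisticToContinuum.Crystallization.Theorems.FrustratedLawDichotomyStrainedPatchHomCurvLJ

open scoped BigOperators RealInnerProductSpace
open Literature.Analysis.ValidatedNumerics.Numerics
open Summit.AtomisticToContinuum.Crystallization.Theorems.ChargedEnergyGapNegative (E3)
open Summit.AtomisticToContinuum.Crystallization.Theorems.FrustratedLawDichotomyStrainedPatchHomSplit (latPt hexFrame hcpShift)
open Summit.AtomisticToContinuum.Crystallization.Theorems.FrustratedLawDichotomyStrainedPatchHomEntryGram (entryFI mem_entryFI)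
open Summit.AtomisticToContinuum.Crystallization.Theorems.FrustratedLawDichotomyStrainedPatchHomEntryGramHcp (dot3 shufFI mem_dot3 mem_shufFI)
open Summit.AtomisticToContinuum.Crystallization.Theorems.FrustratedLawDichotomyStrainedPatchHomForceKit (vecB mem_vecB phiFI mem_phiFI)
open Summit.AtomisticToContinuum.Crystallization.Theorems.FrustratedLawDichotomyStrainedPatchHomCurvCoeff (alphaLJFI mem_alphaLJFI)
open Summit.AtomisticToContinuum.Crystallization.Theorems.FrustratedLawDichotomyStrainedPatchHomCurvCoeff3 (ljTripleFI mem_ljTripleFI kTermS)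
open Summit.AtomisticToContinuum.Crystallization.Theorems.FrustratedLawDichotomyStrainedPatchHomCurvRegime3 (alphaLJ betaLJ alpha1LJ)
open Summit.AtomisticToContinuum.Crystallization.Theorems.FrustratedLawDichotomyStrainedPatchHomCurvKit (accFI mem_accFI hessEntryFI mem_hessEntryFI)
open Summit.AtomisticToContinuum.Crystallization.Theorems.FrustratedLawDichotomyStrainedPatchHomHertzKit (hertzTest quadForm_ge_of_hertzTest hertzSup hertzSup_spec)
open Summit.AtomisticToContinuum.Crystallization.Theorems.FrustratedLawDichotomyStrainedPatchHomConvexCurvature (norm_sq_eq_sum)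
open Summit.AtomisticToContinuum.Crystallization.Theorems.FrustratedLawDichotomyStrainedPatchHomCurvCentre (pert_rearrange pert_abs_le sum_floor_collect)
open Summit.AtomisticToContinuum.Crystallization.Theorems.FrustratedLawDichotomyStrainedPatchHomCurvCentreKit
open Summit.AtomisticToContinuum.Crystallization.Theorems.FrustratedLawDichotomyStrainedPatchHomCurvLeafL (dflt3 labelSum_eq_form rem_term_le form_add3)
open Summit.AtomisticToContinuum.Crystallization.Theorems.FrustratedLawDichotomyStrainedPatchHomCurvLeaf (abs_sub_le_of_segment)
open Summit.AtomisticToContinuum.Crystallization.Theorems.FrustratedLawDichotomyStrainedPatchTaylorChord (segR segGd)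
open Summit.AtomisticToContinuum.Crystallization.Theorems.FrustratedLawDichotomyStrainedPatchHomLatticeBoxHcp (norm_shifted_gt)

/-! ## §1. Full symmetric shift of an interval matrix and the shifted sign-vertex bound -/

/-- Subtract the scaled integer matrix `D` from an interval matrix, entrywise. -/
def shiftMat (E : Fin 3 → Fin 3 → FI) (D : Fin 3 → Fin 3 → ℤ) (i j : Fin 3) : FI := (E i j).sub (FI.ofScaled (D i j))

/-- Membership under the shift. [folklore] -/
theorem mem_shiftMat {E : Fin 3 → Fin 3 → FI} {M : Fin 3 → Fin 3 → ℝ} (hM : ∀ i j, FI.mem (M i j) (E i j)) (D : Fin 3 → Fin 3 → ℤ) (i j : Fin 3) :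
    FI.mem (M i j - (D i j : ℝ) / SC) (shiftMat E D i j) :=
  FI.mem_sub (hM i j) (FI.mem_ofScaled (D i j))

/-- ★ **Shifted sign-vertex bound**: `hertzTest (shiftMat E D) W κS` ⟹ `(κS/SC)Σx_i² + Σ_ij (D_ij/SC)x_ix_j ≤ Σ_ij (M_ij + P_ij)x_ix_j`. [folklore] -/
theorem quadForm_ge_mat_of_hertzTest {E : Fin 3 → Fin 3 → FI} {W : Fin 3 → Fin 3 → ℤ} {D : Fin 3 → Fin 3 → ℤ} {κS : ℤ}
    (h : hertzTest (shiftMat E D) W κS = true) {M P : Fin 3 → Fin 3 → ℝ} (hM : ∀ i j, FI.mem (M i j) (E i j))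
    (hP : ∀ i j, |P i j| * SC ≤ (W i j : ℝ)) (x : Fin 3 → ℝ) :
    (κS : ℝ) / SC * ∑ i, x i ^ 2 + ∑ i, ∑ j, (D i j : ℝ) / SC * (x i * x j) ≤ ∑ i, ∑ j, (M i j + P i j) * (x i * x j) := by
  have key := quadForm_ge_of_hertzTest h (M := fun i j => M i j - (D i j : ℝ) / SC) (P := P) (fun i j => mem_shiftMat hM D i j) hP x
  have hsplit : ∑ i, ∑ j, (M i j - (D i j : ℝ) / SC + P i j) * (x i * x j) =
      ∑ i, ∑ j, (M i j + P i j) * (x i * x j) - ∑ i, ∑ j, (D i j : ℝ) / SC * (x i * x j) := by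
    rw [← Finset.sum_sub_distrib]
    refine Finset.sum_congr rfl fun i _ => ?_
    rw [← Finset.sum_sub_distrib]
    exact Finset.sum_congr rfl fun j _ => by ring
  rw [hsplit] at key
  linarith

/-! ## §2. The anisotropic leaf and its soundness -/

/-- ★ **THE MATRIX-SHIFTED LJ CURVATURE CHECK**: as `curvCheckLJ`, with the centre+naive interval matrix shifted by `D`. -/
def curvCheckLJM (c w : (Fin 3 × Fin 3) ⊕ Fin 3 → ℤ) (Lc Ln : List (Fin 3 → ℤ)) (D : Fin 3 → Fin 3 → ℤ) (lamS : ℤ) : Bool :=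
  (Lc.all fun b => ljLabelOK c w b) && (Ln.all fun b => (naiveLJ c w b).isSome) &&
    hertzTest (shiftMat (fun i j => (EcLJ c Lc i j).add (EnLJ c w Ln i j)) D) (WmatLJ c w Lc) (lamS + remLJ c w Lc)


/-- ★ **The computed matrix-shifted floor** (`none` if the sign-vertex search fails). -/
def curvLamLJM (c w : (Fin 3 × Fin 3) ⊕ Fin 3 → ℤ) (Lc Ln : List (Fin 3 → ℤ)) (D : Fin 3 → Fin 3 → ℤ) : Option ℤ :=
  (hertzSup (shiftMat (fun i j => (EcLJ c Lc i j).add (EnLJ c w Ln i j)) D) (WmatLJ c w Lc)).map fun κ => κ - remLJ c w Lc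

/-- The computed floor passes the leaf. [formal bookkeeping] -/
theorem curvCheckLJM_of_curvLamLJM {c w : (Fin 3 × Fin 3) ⊕ Fin 3 → ℤ} {Lc Ln : List (Fin 3 → ℤ)} {D : Fin 3 → Fin 3 → ℤ} {lamS : ℤ}
    (h : curvLamLJM c w Lc Ln D = some lamS) (hcen : (Lc.all fun b => ljLabelOK c w b) = true)
    (hnai : (Ln.all fun b => (naiveLJ c w b).isSome) = true) : curvCheckLJM c w Lc Ln D lamS = true := by
  unfold curvLamLJM at h
  cases hs : hertzSup (shiftMat (fun i j => (EcLJ c Lc i j).add (EnLJ c w Ln i j)) D) (WmatLJ c w Lc) with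
  | none => rw [hs] at h; exact absurd h (by simp)
  | some κ =>
    rw [hs] at h
    simp only [Option.map_some, Option.some.injEq] at h
    have hκ := hertzSup_spec hs
    unfold curvCheckLJM
    simp only [Bool.and_eq_true]
    refine ⟨⟨hcen, hnai⟩, ?_⟩
    rw [← h, sub_add_cancel]
    exact hκ

/-- ★★★ **SOUNDNESS OF THE MATRIX-SHIFTED LJ CURVATURE LEAF**: the certified form is `(lamS/SC)‖Δ‖² + Σ_ij (D_ij/SC) Δ_iΔ_j`, `Δ = U(ξ−ξ₀)` (feed `…HomForceRing.hcpForceLJ_slab_confinement` with the segment constant `lam := lamS/SC + ⟨Δ,DΔ⟩/(SC‖Δ‖²)`):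
for `U` with entries in the box, `‖U − 1‖ ≤ 1/4`, shuffles `ξ₀, ξ` in the box with norms `≤ 1/4`, every `s ∈ (0,1)`:
`(lamS/SC)·‖U(ξ−ξ₀)‖² ≤ Σ_b segGd (fun x => x⁻¹^7 − x⁻¹^13) (latPt U hexFrame b + U(hcpShift+ξ₀)) (U(ξ−ξ₀)) s`. [folklore chaining] -/
theorem curvLJ_floorM_of_check {c w : (Fin 3 × Fin 3) ⊕ Fin 3 → ℤ} {Lc Ln : List (Fin 3 → ℤ)} (hL : (Lc ++ Ln).Nodup) {lamS : ℤ}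
    {D : Fin 3 → Fin 3 → ℤ}
    (h : curvCheckLJM c w Lc Ln D lamS = true) (U : E3 →L[ℝ] E3) (hU : ‖U - 1‖ ≤ 1 / 4)
    (hbox : ∀ ab : Fin 3 × Fin 3, |(U (EuclideanSpace.single ab.2 (1 : ℝ))) ab.1 - (c (Sum.inl ab) : ℝ) / SC| ≤ (w (Sum.inl ab) : ℝ) / SC)
    (ξ₀ ξ : E3) (hξ₀ : ∀ i : Fin 3, |ξ₀ i - (c (Sum.inr i) : ℝ) / SC| ≤ (w (Sum.inr i) : ℝ) / SC)
    (hξ : ∀ i : Fin 3, |ξ i - (c (Sum.inr i) : ℝ) / SC| ≤ (w (Sum.inr i) : ℝ) / SC) (hn₀ : ‖ξ₀‖ ≤ 1 / 4) (hn : ‖ξ‖ ≤ 1 / 4)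
    {s : ℝ} (hs : s ∈ Set.Ioo (0 : ℝ) 1) :
    (lamS : ℝ) / SC * ‖U (ξ - ξ₀)‖ ^ 2 + ∑ i : Fin 3, ∑ j : Fin 3, (D i j : ℝ) / SC * ((U (ξ - ξ₀)) i * (U (ξ - ξ₀)) j) ≤
      ∑ b ∈ (Lc ++ Ln).toFinset, segGd (fun x : ℝ => x⁻¹ ^ 7 - x⁻¹ ^ 13) (latPt U hexFrame b + U (hcpShift + ξ₀)) (U (ξ - ξ₀)) s := by
  classical
  have hS : (0 : ℝ) < SC := by norm_num [SC]
  unfold curvCheckLJM at h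
  simp only [Bool.and_eq_true, List.all_eq_true] at h
  obtain ⟨⟨hcen, hnai⟩, hhz⟩ := h
  obtain ⟨hLc, hLn, hdisj⟩ := List.nodup_append.1 hL
  have hdisj' : List.Disjoint Lc Ln := fun a ha hb => hdisj a ha a hb rfl
  -- the intermediate shuffle
  set η : E3 := ξ₀ + s • (ξ - ξ₀) with hη
  have hηbox : ∀ i : Fin 3, |η i - (c (Sum.inr i) : ℝ) / SC| ≤ (w (Sum.inr i) : ℝ) / SC := by
    intro i
    have : η i = ξ₀ i + s * (ξ i - ξ₀ i) := by simp [hη]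
    rw [this]
    exact abs_sub_le_of_segment (hξ₀ i) (hξ i) hs.1.le hs.2.le
  have hηn : ‖η‖ ≤ 1 / 4 := by
    have hdec : η = (1 - s) • ξ₀ + s • ξ := by
      rw [hη, smul_sub, sub_smul, one_smul]; abel
    rw [hdec]
    calc ‖(1 - s) • ξ₀ + s • ξ‖ ≤ ‖(1 - s) • ξ₀‖ + ‖s • ξ‖ := norm_add_le _ _
      _ = (1 - s) * ‖ξ₀‖ + s * ‖ξ‖ := by
          rw [norm_smul, norm_smul, Real.norm_eq_abs, Real.norm_eq_abs, abs_of_nonneg (by linarith [hs.2]), abs_of_nonneg hs.1.le]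
      _ ≤ (1 - s) * (1 / 4) + s * (1 / 4) := by gcongr <;> linarith [hs.1, hs.2]
      _ = 1 / 4 := by ring
  have hpt : ∀ b : Fin 3 → ℤ, latPt U hexFrame b + U (hcpShift + ξ₀) + s • U (ξ - ξ₀) = latPt U hexFrame b + U (hcpShift + η) := by
    intro b
    have : U (hcpShift + η) = U (hcpShift + ξ₀) + s • U (ξ - ξ₀) := by
      rw [hη, ← map_smul, ← map_add]; congr 1; abel
    rw [this, add_assoc]
  set Δ : E3 := U (ξ - ξ₀) with hΔ
  set cb : (Fin 3 → ℤ) → E3 := fun b => latPt U hexFrame b + U (hcpShift + η) with hcb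
  have hρpos : ∀ b : Fin 3 → ℤ, 0 < ‖cb b‖ := fun b => lt_trans (by norm_num) (norm_shifted_gt hU hηn b)
  have hsegR : ∀ b : Fin 3 → ℤ, segR (latPt U hexFrame b + U (hcpShift + ξ₀)) Δ s = ‖cb b‖ := by
    intro b; rw [segR, hpt]
  -- the summands are `alphaLJ‖c_b‖⟪c_b,Δ⟫² + betaLJ‖c_b‖‖Δ‖²`
  have hsummand : ∀ b ∈ (Lc ++ Ln).toFinset,
      segGd (fun x : ℝ => x⁻¹ ^ 7 - x⁻¹ ^ 13) (latPt U hexFrame b + U (hcpShift + ξ₀)) Δ s = alphaLJ ‖cb b‖ * ⟪cb b, Δ⟫ ^ 2 + betaLJ ‖cb b‖ * ‖Δ‖ ^ 2 := by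
    intro b _
    have h0 : segR (latPt U hexFrame b + U (hcpShift + ξ₀)) Δ s ≠ 0 := by rw [hsegR]; exact (hρpos b).ne'
    rw [segGd_ljProfile_eq _ _ h0, hsegR, hpt]
  rw [Finset.sum_congr rfl hsummand, List.toFinset_append, Finset.sum_union (List.disjoint_toFinset_iff_disjoint.2 hdisj')]
  -- NAIVE part
  have hCn : ∀ (b : Fin 3 → ℤ) (a : Fin 3), FI.mem (cb b a) (vecB (boxE c w) (shufFI c w) b a) :=
    fun b a => mem_vecB U η (fun ab => mem_entryFI (hbox ab)) (fun i => mem_shufFI (hηbox i)) b a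
  have hQn : ∀ b : Fin 3 → ℤ, FI.mem (‖cb b‖ ^ 2) (dot3 (vecB (boxE c w) (shufFI c w) b) (vecB (boxE c w) (shufFI c w) b)) := by
    intro b; rw [← real_inner_self_eq_norm_sq]; exact mem_dot3 (hCn b) (hCn b)
  have hαn : ∀ b ∈ Ln, FI.mem (alphaLJ ‖cb b‖) ((naiveLJ c w b).getD (FI.ofInt 0, FI.ofInt 0)).1 ∧
      FI.mem (betaLJ ‖cb b‖) ((naiveLJ c w b).getD (FI.ofInt 0, FI.ofInt 0)).2 := by
    intro b hb
    obtain ⟨AB, hAB⟩ := Option.isSome_iff_exists.1 (hnai b hb)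
    have := mem_naiveLJ hAB (hQn b)
    rw [hAB]; simpa using this
  have hMn := fun i j => mem_hessEntryFI Ln hLn (fun b hb => (hαn b hb).1) (fun b hb => (hαn b hb).2) (fun b _ a => hCn b a) i j
  have hNsum := labelSum_eq_form Ln.toFinset (fun b => alphaLJ ‖cb b‖) (fun b => betaLJ ‖cb b‖) cb Δ
  -- CENTRED part
  have hlf := fun b (hb : b ∈ Lc) => labelLJ_floor (hcen b hb) U hbox η hηbox Δ
  set pc : (Fin 3 → ℤ) → E3 := fun b => cenPt c b with hpc
  set a1 : (Fin 3 → ℤ) → ℝ := fun b => alpha1LJ ‖pc b‖ / ‖pc b‖ with ha1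
  set D : (Fin 3 → ℤ) → Fin 3 → Fin 3 → Fin 3 → ℝ := fun b k i j => Dreal (a1 b) (alphaLJ ‖pc b‖) (pc b) k i j with hD
  have hfloor : ∀ b ∈ Lc.toFinset, alphaLJ ‖pc b‖ * ⟪pc b, Δ⟫ ^ 2 + betaLJ ‖pc b‖ * ‖Δ‖ ^ 2 +
      ∑ i, ∑ j, (∑ k, (cb b - pc b) k * D b k i j) * (Δ i * Δ j) - (KSlj c w b : ℝ) / SC / 2 * ((nd2S2 c w b : ℝ) / SC) * ‖Δ‖ ^ 2 ≤
      alphaLJ ‖cb b‖ * ⟪cb b, Δ⟫ ^ 2 + betaLJ ‖cb b‖ * ‖Δ‖ ^ 2 := fun b hb => (hlf b (List.mem_toFinset.1 hb)).2.2.2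
  have hC := sum_floor_collect Lc.toFinset (fun b => alphaLJ ‖cb b‖ * ⟪cb b, Δ⟫ ^ 2 + betaLJ ‖cb b‖ * ‖Δ‖ ^ 2)
    (fun b => alphaLJ ‖pc b‖ * ⟪pc b, Δ⟫ ^ 2 + betaLJ ‖pc b‖ * ‖Δ‖ ^ 2) (fun b => (KSlj c w b : ℝ) / SC / 2 * ((nd2S2 c w b : ℝ) / SC))
    (fun b k => (cb b - pc b) k) D Δ hfloor
  have hqsum := labelSum_eq_form Lc.toFinset (fun b => alphaLJ ‖pc b‖) (fun b => betaLJ ‖pc b‖) pc Δ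
  have hMc := fun i j => mem_hessEntryFI Lc hLc (fun b hb => (hlf b hb).1) (fun b hb => (hlf b hb).2.1) (fun b _ a => mem_cenVec c b a) i j
  -- the perturbation array and its entrywise bound
  set P : Fin 3 → Fin 3 → ℝ := fun i j => ∑ b ∈ Lc.toFinset, ∑ k, (cb b - pc b) k * D b k i j with hP
  have hPbound : ∀ i j, |P i j| * SC ≤ (WmatLJ c w Lc i j : ℝ) := by
    intro i j
    have hd : ∀ (b : Fin 3 → ℤ) (k : Fin 3), (cb b - pc b) k =
        ∑ l : Fin 3, ((U (EuclideanSpace.single l (1 : ℝ))) k - (c (Sum.inl (k, l)) : ℝ) / SC) * wPt c b l + (U (η - cenShuf c)) k :=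
      fun b k => dVec_formula c U η b k
    have hre : P i j = ∑ k, ∑ l, ((U (EuclideanSpace.single l (1 : ℝ))) k - (c (Sum.inl (k, l)) : ℝ) / SC) *
        (∑ b ∈ Lc.toFinset, wPt c b l * D b k i j) + ∑ k, (U (η - cenShuf c)) k * ∑ b ∈ Lc.toFinset, D b k i j := by
      rw [hP]
      simp only []
      rw [Finset.sum_congr rfl fun b _ => Finset.sum_congr rfl fun k _ => by rw [hd b k]]
      exact pert_rearrange Lc.toFinset (fun k l => (U (EuclideanSpace.single l (1 : ℝ))) k - (c (Sum.inl (k, l)) : ℝ) / SC)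
        (fun k => (U (η - cenShuf c)) k) (fun b l => wPt c b l) (fun b k => D b k i j)
    have hG : ∀ k l, FI.mem (∑ b ∈ Lc.toFinset, wPt c b l * D b k i j) (GarrLJ c w Lc k l i j) := by
      intro k l
      refine mem_accFI Lc hLc fun b hb => ?_
      rw [mul_comm]
      exact FI.mem_mul (mem_Darr (L := recLJ c w b) (hlf b hb).2.2.1 (hlf b hb).1 (fun a => mem_cenVec c b a) k i j) (mem_wVec c b l)
    have hT : ∀ k, FI.mem (∑ b ∈ Lc.toFinset, D b k i j) (TarrLJ c w Lc k i j) := by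
      intro k
      exact mem_accFI Lc hLc fun b hb => mem_Darr (L := recLJ c w b) (hlf b hb).2.2.1 (hlf b hb).1 (fun a => mem_cenVec c b a) k i j
    have habs := pert_abs_le (fun k l => (U (EuclideanSpace.single l (1 : ℝ))) k - (c (Sum.inl (k, l)) : ℝ) / SC)
      (fun k l => ∑ b ∈ Lc.toFinset, wPt c b l * D b k i j) (fun k l => (w (Sum.inl (k, l)) : ℝ) / SC)
      (fun k l => ((GarrLJ c w Lc k l i j).absHi : ℝ) / SC) (fun k => (U (η - cenShuf c)) k) (fun k => ∑ b ∈ Lc.toFinset, D b k i j)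
      (fun k => (uBound c w k : ℝ) / SC) (fun k => ((TarrLJ c w Lc k i j).absHi : ℝ) / SC)
      (fun k l => hbox (k, l)) (fun k l => by rw [le_div_iff₀ hS]; exact FI.abs_le_absHi (hG k l))
      (fun k => by rw [le_div_iff₀ hS]; exact abs_shift_le U hbox η hηbox k) (fun k => by rw [le_div_iff₀ hS]; exact FI.abs_le_absHi (hT k))
    rw [← hre] at habs
    have hsum : (∑ k : Fin 3, ∑ l : Fin 3, (w (Sum.inl (k, l)) : ℝ) / SC * (((GarrLJ c w Lc k l i j).absHi : ℝ) / SC) +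
        ∑ k : Fin 3, (uBound c w k : ℝ) / SC * (((TarrLJ c w Lc k i j).absHi : ℝ) / SC)) * SC =
        ((∑ k : Fin 3, ∑ l : Fin 3, w (Sum.inl (k, l)) * (GarrLJ c w Lc k l i j).absHi + ∑ k : Fin 3, uBound c w k * (TarrLJ c w Lc k i j).absHi : ℤ) : ℝ) / SC := by
      push_cast
      rw [eq_div_iff hS.ne']
      simp only [add_mul, Finset.sum_mul]
      congr 1
      · refine Finset.sum_congr rfl fun k _ => Finset.sum_congr rfl fun l _ => ?_
        field_simp
      · refine Finset.sum_congr rfl fun k _ => ?_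
        field_simp
    have hcd := div_le_cdiv (a := ∑ k : Fin 3, ∑ l : Fin 3, w (Sum.inl (k, l)) * (GarrLJ c w Lc k l i j).absHi +
      ∑ k : Fin 3, uBound c w k * (TarrLJ c w Lc k i j).absHi) (b := (SC : ℤ)) (by exact_mod_cast hS)
    calc |P i j| * SC ≤ _ := mul_le_mul_of_nonneg_right habs hS.le
      _ = _ := hsum
      _ ≤ (WmatLJ c w Lc i j : ℝ) := by rw [WmatLJ]; exact_mod_cast hcd
  -- remainder
  have hR := remLJ_sum_le c w (Lc := Lc) hLc
  -- the sign-vertex test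
  have key := quadForm_ge_mat_of_hertzTest hhz (M := fun i j => (∑ b ∈ Lc.toFinset, (alphaLJ ‖pc b‖ * (pc b i * pc b j) + if i = j then betaLJ ‖pc b‖ else 0)) +
      ∑ b ∈ Ln.toFinset, (alphaLJ ‖cb b‖ * (cb b i * cb b j) + if i = j then betaLJ ‖cb b‖ else 0)) (P := P)
    (fun i j => FI.mem_add (hMc i j) (hMn i j)) hPbound (fun i => Δ i)
  rw [form_add3, ← hqsum, ← hNsum, ← norm_sq_eq_sum] at key
  have hΔ2 : 0 ≤ ‖Δ‖ ^ 2 := sq_nonneg _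
  have hcast : (((lamS + remLJ c w Lc : ℤ) : ℝ)) / SC = (lamS : ℝ) / SC + (remLJ c w Lc : ℝ) / SC := by push_cast; ring
  rw [hcast] at key
  have hRle : (∑ b ∈ Lc.toFinset, (KSlj c w b : ℝ) / SC / 2 * ((nd2S2 c w b : ℝ) / SC)) * ‖Δ‖ ^ 2 ≤ (remLJ c w Lc : ℝ) / SC * ‖Δ‖ ^ 2 :=
    mul_le_mul_of_nonneg_right hR hΔ2
  nlinarith [key, hC, hRle, hΔ2]

end Summit.AtomisticToContinuum.Crystallization.Theorems.FrustratedLawDichotomyStrainedPatchHomCurvLJ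

end
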